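import Literature.Analysis.FluidPDE.OseenMildHolder
import HarnessLib

/-!
# Uniform Hölder modulus of bounded solutions of a PERTURBED (forced) Oseen integral equation

Analysis/FluidPDE support file (everything proved, no definitions). The tree's
`exists_holder_quarter_of_oseenMild` (`OseenMildHolder.lean`) is the equicontinuity behind
Koch–Nadirashvili–Seregin–Šverák's compactness Lemma 6.1 (arXiv:0709.3599 p. 11; Lemma 4.1 p. 8)
for bounded fields obeying the UNFORCED restart identity `u(t) = e^{(t−s)Δ}u(s) − B¹_s(u,u)(t)`.
A Navier–Stokes solution driven by a force `g` obeys instead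
`u(t) = e^{(t−s)Δ}u(s) − B¹_s(u,u)(t) + ∫ₛᵗ e^{(t−τ)Δ} P g(τ) dτ` (KNSS 2009, §3 (3.4)–(3.6) with a
right-hand side; the tree's `forceDuhamel`, `ForcedOseenRepresentation.lean`, with
`‖∫ₛᵗ e^{(t−τ)Δ}g dτ‖ ≤ (t − s)·sup‖g‖`, `norm_forceDuhamel_le`). This file proves that the SAME
`1/4`-Hölder modulus survives any additive perturbation of the identity that is `O(√lag)` over
short lags — which is all the proof of the unforced modulus uses of the bilinear term:

* `exists_holder_quarter_of_oseenMild_perturbed` — there is `K₀ = K₀(E) > 0` such that: if the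
  slices `u t`, `t ∈ [a, b]`, are continuous and bounded by `m ≥ 0`, and
  `u t x = e^{(t−s)Δ}u(s)(x) − B¹_s(u,u)(t)(x) + G s t x` for all `a ≤ s < t ≤ b` with a perturbation
  obeying `‖G s t x‖ ≤ N √(t − s)` whenever `0 < t − s ≤ 1` (`N ≥ 0`), then
  `‖u(t', x') − u(t, x)‖ ≤ K₀ (m + m² + N) max(|t' − t|, ‖x' − x‖)^{1/4}` for all
  `t, t' ∈ [a + 1, b]` and all `x, x'`.
  Proof = the unforced proof verbatim (restart at lag `ε`: `u(t) = A − B + G` with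
  `A = e^{εΔ}u(t−ε)` `2^{n/2}ε^{-1/2}m`-Lipschitz and bounded by `m`, `‖B‖ ≤ 2Cm²√ε`,
  `‖G‖ ≤ N√ε`; space modulus `2^{n/2}mε^{-1/2}‖x'−x‖ + 4Cm²√ε + 2N√ε`; time modulus from the
  restart at `t` and the mollification error of the Lipschitz part, with the extra `2N√ε + N√h`;
  choice `ε = √δ`), the perturbation riding along with the small part.
* `exists_holder_quarter_of_oseenMild_forced_bounded` — the case of a perturbation that is linear
  in the lag, `‖G s t x‖ ≤ N (t − s)` (a heat Duhamel integral of a force bounded by `N`,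
  `norm_forceDuhamel_le`): `N(t − s) ≤ N√(t − s)` for lags `≤ 1`.

Consumers: the forced twin of the KNSS Lemma 6.1 engine `exists_oseenMild_limit_of_monotone_bound`
(`AncientMildCompactness.lean`) — with this modulus and the general-modulus / Hölder diagonal
extraction (`HolderExtraction.lean`, `ModulusSlabExtraction.lean`) the compactness of a sequence of
bounded forced Oseen-mild fields with forcing terms uniformly `O(√lag)` reduces to dominated
convergence in the identities; e.g. the ladder-limit step `LocalCompactness` of
`Summits/NavierStokesRegularity/FluidComputer/AngularGalerkinLadder.lean`'s route, whose rung defects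
are scale-invariantly small.

WHAT THIS IS NOT: no statement about which forces produce an admissible `G` beyond the bounded
case; nothing about Navier–Stokes blow-up.

## References

* G. Koch, N. Nadirashvili, G. Seregin, V. Šverák, *Liouville theorems for the Navier–Stokes
  equations and applications*, Acta Math. 203 (2009) = arXiv:0709.3599, §3 (3.4)–(3.8), §4 p. 8
  ((4.3)–(4.5), Lemma 4.1) and §6 Lemma 6.1 p. 11. [KochNadirashviliSereginSverak2009]
-/

noncomputable section

open MeasureTheory Set Function Filter
open _root_.Topology

namespace Literature.Analysis.FluidPDE

variable {E : Type*} [NormedAddCommGroup E] [InnerProductSpace ℝ E] [FiniteDimensional ℝ E]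
  [MeasurableSpace E] [BorelSpace E]

-- one long restart-and-optimise estimate (the unforced sibling sits on the same heartbeat cliff)
set_option maxHeartbeats 400000 in
/-- **Uniform `1/4`-Hölder modulus of bounded solutions of a perturbed Oseen integral equation**
(the equicontinuity behind KNSS 2009, Lemma 4.1 / Lemma 6.1, for the identity with a right-hand
side): there is `K₀ = K₀(E) > 0` such that for every field `u : ℝ → E → E` whose slices `u t`,
`t ∈ [a, b]`, are continuous and bounded by `m ≥ 0`, which satisfies
`u(t) = e^{(t−s)Δ}u(s) − B¹_s(u,u)(t) + G(s,t)` pointwise for all `a ≤ s < t ≤ b` with a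
perturbation `‖G(s,t)(x)‖ ≤ N √(t − s)` for `0 < t − s ≤ 1` (`N ≥ 0`), one has
`‖u(t', x') − u(t, x)‖ ≤ K₀ (m + m² + N) max(|t' − t|, ‖x' − x‖)^{1/4}` for all
`t, t' ∈ [a + 1, b]` and all `x, x'`.
[cite: KochNadirashviliSereginSverak2009, Lemma 4.1 and Lemma 6.1 (arXiv:0709.3599 pp. 8, 11)] -/
theorem exists_holder_quarter_of_oseenMild_perturbed :
    ∃ K₀ : ℝ, 0 < K₀ ∧ ∀ ⦃u : ℝ → E → E⦄ ⦃G : ℝ → ℝ → E → E⦄ ⦃a b m N : ℝ⦄, 0 ≤ m → 0 ≤ N →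
      (∀ t ∈ Icc a b, Continuous (u t)) →
      (∀ t ∈ Icc a b, ∀ x, ‖u t x‖ ≤ m) →
      (∀ s t : ℝ, a ≤ s → s < t → t ≤ b → ∀ x,
        u t x = UnboundedOperators.heatExtension (u s) (t - s) x - oseenDuhamel 1 s u u t x +
          G s t x) →
      (∀ s t : ℝ, a ≤ s → s < t → t ≤ b → t - s ≤ 1 → ∀ x, ‖G s t x‖ ≤ N * Real.sqrt (t - s)) →
      ∀ t ∈ Icc (a + 1) b, ∀ t' ∈ Icc (a + 1) b, ∀ x x' : E,
        ‖u t' x' - u t x‖ ≤ K₀ * (m + m ^ 2 + N) * (max |t' - t| ‖x' - x‖) ^ (1 / 4 : ℝ) := by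
  obtain ⟨C, hC, hB⟩ := exists_norm_oseenDuhamel_bounded_le (E := E)
  set D : ℝ := (2 : ℝ) ^ ((Module.finrank ℝ E : ℝ) / 2) with hD
  set H : ℝ := 1 + 2 * (2 : ℝ) ^ ((Module.finrank ℝ E : ℝ) / 2) with hH
  have hD0 : 0 < D := by positivity
  have hH0 : 0 < H := by positivity
  refine ⟨D + H * D + 10 * C + 5, by positivity, ?_⟩
  intro u G a b m N hm hN hcont hbd hmild hG
  -- the Duhamel bound with `ν = 1`
  have hB1 : ∀ s t : ℝ, a ≤ s → s < t → t ≤ b → ∀ x,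
      ‖oseenDuhamel 1 s u u t x‖ ≤ C * m ^ 2 * (2 * Real.sqrt (t - s)) := by
    intro s t has hst htb x
    have h := hB one_pos hst hm (fun τ hτ y => hbd τ ⟨has.trans hτ.1.le, hτ.2.le.trans htb⟩ y)
      (fun τ hτ y => hbd τ ⟨has.trans hτ.1.le, hτ.2.le.trans htb⟩ y) x
    simpa [Real.one_rpow] using h
  -- ### the decomposition at a time `t ∈ [a + 1, b]` with lag `0 < ε ≤ 1`
  -- `u t = A − B + G(t−ε,t)`, `A = e^{εΔ}u(t − ε)` Lipschitz with constant `D ε^{-1/2} m`,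
  -- `‖B‖ ≤ 2 C m² √ε`, `‖G(t−ε,t)‖ ≤ N √ε`
  have hdec : ∀ t ∈ Icc (a + 1) b, ∀ ε : ℝ, 0 < ε → ε ≤ 1 →
      (∀ x, u t x = UnboundedOperators.heatExtension (u (t - ε)) ε x -
        oseenDuhamel 1 (t - ε) u u t x + G (t - ε) t x) ∧
      (∀ x x', ‖UnboundedOperators.heatExtension (u (t - ε)) ε x' -
          UnboundedOperators.heatExtension (u (t - ε)) ε x‖ ≤ D * ε ^ (-(1 / 2 : ℝ)) * m * ‖x' - x‖) ∧
      (∀ x, ‖UnboundedOperators.heatExtension (u (t - ε)) ε x‖ ≤ m) ∧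
      (∀ x, ‖oseenDuhamel 1 (t - ε) u u t x‖ ≤ 2 * C * m ^ 2 * Real.sqrt ε) ∧
      (∀ x, ‖G (t - ε) t x‖ ≤ N * Real.sqrt ε) := by
    intro t ht ε hε hε1
    have has : a ≤ t - ε := by linarith [ht.1]
    have hsI : t - ε ∈ Icc a b := ⟨has, by linarith [ht.2]⟩
    refine ⟨fun x => ?_, fun x x' => ?_, fun x => ?_, fun x => ?_, fun x => ?_⟩
    · have h := hmild (t - ε) t has (by linarith) ht.2 x
      rwa [sub_sub_cancel] at h
    · exact norm_heatExtension_sub_le_mul_norm_sub_of_bound (hcont _ hsI) (hbd _ hsI) hε x x'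
    · exact UnboundedOperators.norm_heatExtension_le_of_bound (hbd _ hsI) hε x
    · have h := hB1 (t - ε) t has (by linarith) ht.2 x
      rw [sub_sub_cancel] at h
      linarith
    · have h := hG (t - ε) t has (by linarith) ht.2 (by linarith) x
      rwa [sub_sub_cancel] at h
  -- ### space modulus
  have hspace : ∀ t ∈ Icc (a + 1) b, ∀ ε : ℝ, 0 < ε → ε ≤ 1 → ∀ x x',
      ‖u t x' - u t x‖ ≤ D * ε ^ (-(1 / 2 : ℝ)) * m * ‖x' - x‖ + 4 * C * m ^ 2 * Real.sqrt ε +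
        2 * N * Real.sqrt ε := by
    intro t ht ε hε hε1 x x'
    obtain ⟨hrep, hlip, -, hBb, hGb⟩ := hdec t ht ε hε hε1
    rw [hrep x', hrep x]
    calc ‖UnboundedOperators.heatExtension (u (t - ε)) ε x' - oseenDuhamel 1 (t - ε) u u t x' +
          G (t - ε) t x' -
          (UnboundedOperators.heatExtension (u (t - ε)) ε x - oseenDuhamel 1 (t - ε) u u t x +
            G (t - ε) t x)‖
        = ‖(UnboundedOperators.heatExtension (u (t - ε)) ε x' -
            UnboundedOperators.heatExtension (u (t - ε)) ε x) -
            (oseenDuhamel 1 (t - ε) u u t x' - oseenDuhamel 1 (t - ε) u u t x) +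
            (G (t - ε) t x' - G (t - ε) t x)‖ := by abel_nf
      _ ≤ ‖UnboundedOperators.heatExtension (u (t - ε)) ε x' -
            UnboundedOperators.heatExtension (u (t - ε)) ε x‖ +
            (‖oseenDuhamel 1 (t - ε) u u t x'‖ + ‖oseenDuhamel 1 (t - ε) u u t x‖) +
            (‖G (t - ε) t x'‖ + ‖G (t - ε) t x‖) :=
          (norm_add_le _ _).trans (add_le_add ((norm_sub_le _ _).trans
            (add_le_add le_rfl (norm_sub_le _ _))) (norm_sub_le _ _))
      _ ≤ D * ε ^ (-(1 / 2 : ℝ)) * m * ‖x' - x‖ +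
            (2 * C * m ^ 2 * Real.sqrt ε + 2 * C * m ^ 2 * Real.sqrt ε) +
            (N * Real.sqrt ε + N * Real.sqrt ε) :=
          add_le_add (add_le_add (hlip x x') (add_le_add (hBb x') (hBb x)))
            (add_le_add (hGb x') (hGb x))
      _ = _ := by ring
  -- ### time modulus (lags at most `1`)
  have htime : ∀ t ∈ Icc (a + 1) b, ∀ t' ∈ Icc (a + 1) b, t < t' → t' - t ≤ 1 →
      ∀ ε : ℝ, 0 < ε → ε ≤ 1 → ∀ x,
      ‖u t' x - u t x‖ ≤ H * (D * ε ^ (-(1 / 2 : ℝ)) * m) * (t' - t) ^ ((1 : ℝ) / 2) +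
        4 * C * m ^ 2 * Real.sqrt ε + 2 * N * Real.sqrt ε + 2 * C * m ^ 2 * Real.sqrt (t' - t) +
        N * Real.sqrt (t' - t) := by
    intro t ht t' ht' htt' hlag ε hε hε1 x
    obtain ⟨hrep, hlip, hAb, hBb, hGb⟩ := hdec t ht ε hε hε1
    have hh : 0 < t' - t := sub_pos.2 htt'
    have htI : t ∈ Icc a b := ⟨by linarith [ht.1], ht.2⟩
    -- restart at `t`
    have hrep' : u t' x = UnboundedOperators.heatExtension (u t) (t' - t) x -
        oseenDuhamel 1 t u u t' x + G t t' x :=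
      hmild t t' (by linarith [ht.1]) htt' ht'.2 x
    have hB' : ‖oseenDuhamel 1 t u u t' x‖ ≤ 2 * C * m ^ 2 * Real.sqrt (t' - t) := by
      have h := hB1 t t' (by linarith [ht.1]) htt' ht'.2 x
      linarith
    have hG' : ‖G t t' x‖ ≤ N * Real.sqrt (t' - t) := hG t t' (by linarith [ht.1]) htt' ht'.2 hlag x
    -- `u t = A - Bf` with `A` Lipschitz continuous bounded, `Bf` continuous small
    set A : E → E := UnboundedOperators.heatExtension (u (t - ε)) ε with hA
    set Bf : E → E := fun z => A z - u t z with hBf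
    have hAc : Continuous A :=
      (UnboundedOperators.contDiff_heatExtension_of_bound
        (hcont _ ⟨by linarith [ht.1], by linarith [ht.2]⟩)
        (hbd _ ⟨by linarith [ht.1], by linarith [ht.2]⟩) hε (m := 0)).continuous
    have hBfc : Continuous Bf := hAc.sub (hcont t htI)
    have hBfeq : ∀ z, Bf z = oseenDuhamel 1 (t - ε) u u t z - G (t - ε) t z := fun z => by
      rw [hBf]; dsimp only; rw [hrep z]; abel
    have hBfb : ∀ z, ‖Bf z‖ ≤ 2 * C * m ^ 2 * Real.sqrt ε + N * Real.sqrt ε := fun z => by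
      rw [hBfeq z]
      exact (norm_sub_le _ _).trans (add_le_add (hBb z) (hGb z))
    have hut : u t = fun z => A z - Bf z := funext fun z => by rw [hBf]; dsimp only; abel
    have hsplit : UnboundedOperators.heatExtension (u t) (t' - t) x =
        UnboundedOperators.heatExtension A (t' - t) x -
          UnboundedOperators.heatExtension Bf (t' - t) x := by
      rw [hut]
      exact UnboundedOperators.heatExtension_sub_of_bound hAc hBfc hAb hBfb hh x
    -- the mollification error for the Lipschitz part
    have hAlip : ∀ y z, ‖A y - A z‖ ≤ (D * ε ^ (-(1 / 2 : ℝ)) * m) * ‖y - z‖ ^ (1 : ℝ) :=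
      fun y z => by rw [Real.rpow_one]; exact hlip z y
    have hLA : 0 ≤ D * ε ^ (-(1 / 2 : ℝ)) * m := by positivity
    have hmoll : ‖UnboundedOperators.heatExtension A (t' - t) x - A x‖ ≤
        H * (D * ε ^ (-(1 / 2 : ℝ)) * m) * (t' - t) ^ ((1 : ℝ) / 2) :=
      UnboundedOperators.norm_heatExtension_sub_self_le_of_holder hAc hAb hLA zero_le_one le_rfl
        hAlip hh x
    have hmollB : ‖UnboundedOperators.heatExtension Bf (t' - t) x‖ ≤
        2 * C * m ^ 2 * Real.sqrt ε + N * Real.sqrt ε :=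
      UnboundedOperators.norm_heatExtension_le_of_bound hBfb hh x
    -- assemble
    have hutx : u t x = A x - Bf x := congrFun hut x
    rw [hrep', hsplit, hutx]
    calc ‖UnboundedOperators.heatExtension A (t' - t) x -
          UnboundedOperators.heatExtension Bf (t' - t) x -
          oseenDuhamel 1 t u u t' x + G t t' x - (A x - Bf x)‖
        = ‖(UnboundedOperators.heatExtension A (t' - t) x - A x) -
            UnboundedOperators.heatExtension Bf (t' - t) x + Bf x - oseenDuhamel 1 t u u t' x +
            G t t' x‖ := by
          abel_nf
      _ ≤ ‖UnboundedOperators.heatExtension A (t' - t) x - A x‖ +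
            ‖UnboundedOperators.heatExtension Bf (t' - t) x‖ + ‖Bf x‖ +
            ‖oseenDuhamel 1 t u u t' x‖ + ‖G t t' x‖ := by
          refine (norm_add_le _ _).trans (add_le_add ((norm_sub_le _ _).trans (add_le_add
            ((norm_add_le _ _).trans (add_le_add (norm_sub_le _ _) le_rfl)) le_rfl)) le_rfl)
      _ ≤ H * (D * ε ^ (-(1 / 2 : ℝ)) * m) * (t' - t) ^ ((1 : ℝ) / 2) +
            (2 * C * m ^ 2 * Real.sqrt ε + N * Real.sqrt ε) +
            (2 * C * m ^ 2 * Real.sqrt ε + N * Real.sqrt ε) +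
            2 * C * m ^ 2 * Real.sqrt (t' - t) + N * Real.sqrt (t' - t) :=
          add_le_add (add_le_add (add_le_add (add_le_add hmoll hmollB) (hBfb x)) hB') hG'
      _ = _ := by ring
  -- ### the combination, for `t ≤ t'`
  have key : ∀ t ∈ Icc (a + 1) b, ∀ t' ∈ Icc (a + 1) b, t ≤ t' → ∀ x x' : E,
      ‖u t' x' - u t x‖ ≤
        (D + H * D + 10 * C + 5) * (m + m ^ 2 + N) * (max |t' - t| ‖x' - x‖) ^ (1 / 4 : ℝ) := by
    intro t ht t' ht' htt' x x'
    set δ : ℝ := max |t' - t| ‖x' - x‖ with hδ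
    have hδ0 : 0 ≤ δ := le_max_of_le_left (abs_nonneg _)
    have htI : t ∈ Icc a b := ⟨by linarith [ht.1], ht.2⟩
    have ht'I : t' ∈ Icc a b := ⟨by linarith [ht'.1], ht'.2⟩
    -- trivial bound `2m`
    have htriv : ‖u t' x' - u t x‖ ≤ 2 * m :=
      (norm_sub_le _ _).trans (by linarith [hbd t' ht'I x', hbd t htI x])
    rcases hδ0.eq_or_lt with hδz | hδpos
    · -- `δ = 0`: same point
      have h1 : |t' - t| ≤ 0 := hδz ▸ le_max_left _ _
      have h2 : ‖x' - x‖ ≤ 0 := hδz ▸ le_max_right _ _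
      have e1 : t' = t := by
        have := abs_nonpos_iff.1 h1; linarith
      have e2 : x' = x := by
        have := norm_le_zero_iff.1 h2; exact sub_eq_zero.1 this
      subst e1; subst e2
      simp only [sub_self, norm_zero]
      positivity
    set c : ℝ := δ ^ (1 / 4 : ℝ) with hc
    have hc0 : 0 < c := Real.rpow_pos_of_pos hδpos _
    have hδc : δ = c ^ 4 := by
      rw [hc, ← Real.rpow_natCast, ← Real.rpow_mul hδpos.le]; norm_num
    rcases le_or_gt δ 1 with hδ1 | hδ1
    · -- main case `0 < δ ≤ 1`: `ε = √δ = c²`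
      have hc1 : c ≤ 1 := by
        rw [hc]; exact Real.rpow_le_one hδpos.le hδ1 (by norm_num)
      set ε : ℝ := c ^ 2 with hε
      have hε0 : 0 < ε := by positivity
      have hε1 : ε ≤ 1 := by rw [hε]; nlinarith
      have hεr : ε ^ (-(1 / 2 : ℝ)) = c⁻¹ := sq_rpow_neg_half_eq_inv hc0
      have hsε : Real.sqrt ε = c := by rw [hε, Real.sqrt_sq hc0.le]
      have hsδ : Real.sqrt δ = c ^ 2 := by
        rw [hδc, show c ^ 4 = (c ^ 2) ^ 2 by ring, Real.sqrt_sq (by positivity)]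
      have hc2 : c ^ 2 ≤ c := by nlinarith
      -- space step at time `t'`
      have hxx : ‖x' - x‖ ≤ δ := le_max_right _ _
      have h1 : ‖u t' x' - u t' x‖ ≤ D * m * c ^ 3 + 4 * C * m ^ 2 * c + 2 * N * c := by
        have h := hspace t' ht' ε hε0 hε1 x x'
        rw [hεr, hsε] at h
        refine h.trans ?_
        have : D * c⁻¹ * m * ‖x' - x‖ ≤ D * c⁻¹ * m * δ := by gcongr
        have e : D * c⁻¹ * m * δ = D * m * c ^ 3 := by
          rw [hδc]; field_simp
        linarith
      -- time step at the point `x`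
      have h2 : ‖u t' x - u t x‖ ≤ H * D * m * c + 4 * C * m ^ 2 * c + 2 * N * c +
          2 * C * m ^ 2 * c ^ 2 + N * c ^ 2 := by
        rcases htt'.eq_or_lt with heq | hlt
        · subst heq; simp only [sub_self, norm_zero]; positivity
        · have hh : t' - t ≤ δ := (le_abs_self _).trans (le_max_left _ _)
          have hlag : t' - t ≤ 1 := hh.trans hδ1
          have h := htime t ht t' ht' hlt hlag ε hε0 hε1 x
          rw [hεr, hsε] at h
          have hh0 : 0 ≤ t' - t := by linarith
          have hsh : Real.sqrt (t' - t) ≤ c ^ 2 := hsδ ▸ Real.sqrt_le_sqrt hh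
          have hrh : (t' - t) ^ ((1 : ℝ) / 2) ≤ c ^ 2 := by
            rw [show (1 : ℝ) / 2 = 1 / 2 by norm_num, ← Real.sqrt_eq_rpow]; exact hsh
          refine h.trans ?_
          have e1 : H * (D * c⁻¹ * m) * (t' - t) ^ ((1 : ℝ) / 2) ≤ H * (D * c⁻¹ * m) * c ^ 2 := by
            gcongr
          have e2 : H * (D * c⁻¹ * m) * c ^ 2 = H * D * m * c := by field_simp
          have e3 : 2 * C * m ^ 2 * Real.sqrt (t' - t) ≤ 2 * C * m ^ 2 * c ^ 2 := by gcongr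
          have e4 : N * Real.sqrt (t' - t) ≤ N * c ^ 2 := by gcongr
          linarith
      -- combine: every power of `c` is at most `c`
      have hc3 : c ^ 3 ≤ c := by nlinarith
      calc ‖u t' x' - u t x‖ = ‖(u t' x' - u t' x) + (u t' x - u t x)‖ := by rw [sub_add_sub_cancel]
        _ ≤ ‖u t' x' - u t' x‖ + ‖u t' x - u t x‖ := norm_add_le _ _
        _ ≤ (D * m * c ^ 3 + 4 * C * m ^ 2 * c + 2 * N * c) +
              (H * D * m * c + 4 * C * m ^ 2 * c + 2 * N * c + 2 * C * m ^ 2 * c ^ 2 +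
                N * c ^ 2) := add_le_add h1 h2
        _ ≤ D * m * c + 4 * C * m ^ 2 * c + 2 * N * c +
              (H * D * m * c + 4 * C * m ^ 2 * c + 2 * N * c + 2 * C * m ^ 2 * c + N * c) := by
              have : D * m * c ^ 3 ≤ D * m * c := by
                have := mul_le_mul_of_nonneg_left hc3 (by positivity : 0 ≤ D * m); linarith
              have : 2 * C * m ^ 2 * c ^ 2 ≤ 2 * C * m ^ 2 * c := by
                have := mul_le_mul_of_nonneg_left hc2 (by positivity : 0 ≤ 2 * C * m ^ 2); linarith
              have : N * c ^ 2 ≤ N * c := by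
                have := mul_le_mul_of_nonneg_left hc2 hN; linarith
              linarith
        _ = ((D + H * D) * m + 10 * C * m ^ 2 + 5 * N) * c := by ring
        _ ≤ (D + H * D + 10 * C + 5) * (m + m ^ 2 + N) * c := by
              apply mul_le_mul_of_nonneg_right _ hc0.le
              have h3 : 0 ≤ (D + H * D) * (m ^ 2 + N) := by positivity
              have h4 : 0 ≤ 10 * C * (m + N) := by positivity
              have h5 : 0 ≤ 5 * (m + m ^ 2) := by positivity
              have h6 : (D + H * D + 10 * C + 5) * (m + m ^ 2 + N) -
                  ((D + H * D) * m + 10 * C * m ^ 2 + 5 * N) =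
                  (D + H * D) * (m ^ 2 + N) + 10 * C * (m + N) + 5 * (m + m ^ 2) := by ring
              linarith [h3, h4, h5, h6]
    · -- `δ > 1`: the trivial bound
      have hc1 : 1 ≤ c := by
        rw [hc]; exact Real.one_le_rpow hδ1.le (by norm_num)
      have hHD : 0 < H * D := mul_pos hH0 hD0
      have hK2 : (2 : ℝ) ≤ D + H * D + 10 * C + 5 := by linarith
      have hmsq : 0 ≤ m ^ 2 := sq_nonneg m
      have hm2 : m ≤ m + m ^ 2 + N := by linarith
      have hmN : 0 ≤ m + m ^ 2 + N := by positivity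
      calc ‖u t' x' - u t x‖ ≤ 2 * m := htriv
        _ ≤ 2 * (m + m ^ 2 + N) := by linarith
        _ ≤ (D + H * D + 10 * C + 5) * (m + m ^ 2 + N) := mul_le_mul_of_nonneg_right hK2 hmN
        _ = (D + H * D + 10 * C + 5) * (m + m ^ 2 + N) * 1 := by ring
        _ ≤ (D + H * D + 10 * C + 5) * (m + m ^ 2 + N) * c := by gcongr
  -- ### symmetry in `(t, x) ↔ (t', x')`
  intro t ht t' ht' x x'
  rcases le_total t t' with h | h
  · exact key t ht t' ht' h x x'
  · have hk := key t' ht' t ht h x' x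
    rwa [norm_sub_rev, abs_sub_comm, norm_sub_rev x] at hk

/-- **The bounded-force case.** If the perturbation is a heat Duhamel integral of a force bounded by
`N`, so that `‖G(s,t)(x)‖ ≤ N (t − s)` (tree `norm_forceDuhamel_le`), then over lags `≤ 1` one has
`N(t − s) ≤ N√(t − s)`, and the `1/4`-Hölder modulus of
`exists_holder_quarter_of_oseenMild_perturbed` holds with the same constant.
[cite: KochNadirashviliSereginSverak2009, Lemma 4.1 and Lemma 6.1 (arXiv:0709.3599 pp. 8, 11)] -/
theorem exists_holder_quarter_of_oseenMild_forced_bounded :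
    ∃ K₀ : ℝ, 0 < K₀ ∧ ∀ ⦃u : ℝ → E → E⦄ ⦃G : ℝ → ℝ → E → E⦄ ⦃a b m N : ℝ⦄, 0 ≤ m → 0 ≤ N →
      (∀ t ∈ Icc a b, Continuous (u t)) →
      (∀ t ∈ Icc a b, ∀ x, ‖u t x‖ ≤ m) →
      (∀ s t : ℝ, a ≤ s → s < t → t ≤ b → ∀ x,
        u t x = UnboundedOperators.heatExtension (u s) (t - s) x - oseenDuhamel 1 s u u t x +
          G s t x) →
      (∀ s t : ℝ, a ≤ s → s < t → t ≤ b → ∀ x, ‖G s t x‖ ≤ N * (t - s)) →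
      ∀ t ∈ Icc (a + 1) b, ∀ t' ∈ Icc (a + 1) b, ∀ x x' : E,
        ‖u t' x' - u t x‖ ≤ K₀ * (m + m ^ 2 + N) * (max |t' - t| ‖x' - x‖) ^ (1 / 4 : ℝ) := by
  obtain ⟨K₀, hK₀, h⟩ := exists_holder_quarter_of_oseenMild_perturbed (E := E)
  refine ⟨K₀, hK₀, fun u G a b m N hm hN hcont hbd hmild hG => h hm hN hcont hbd hmild ?_⟩
  intro s t has hst htb hlag x
  refine (hG s t has hst htb x).trans (mul_le_mul_of_nonneg_left ?_ hN)
  -- `t - s ≤ √(t - s)` for `0 ≤ t - s ≤ 1`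
  have h0 : 0 ≤ t - s := by linarith
  have h1 : Real.sqrt (t - s) * Real.sqrt (t - s) = t - s := Real.mul_self_sqrt h0
  have h2 : Real.sqrt (t - s) ≤ 1 := Real.sqrt_le_one.mpr hlag |>.trans_eq' rfl
  nlinarith [Real.sqrt_nonneg (t - s)]

end Literature.Analysis.FluidPDE

end
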